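import Summits.SmoothPoincare4.SmoothPoincare4.Theses.CongruenceShadows
import Summits.SmoothPoincare4.SmoothPoincare4.Theorems.WaldhausenPairs.Negative.LoadBearing
import Summits.SmoothPoincare4.SmoothPoincare4.Theorems.CongruenceShadowsWaldhausenPairsStubSeamDictionary
import Summits.SmoothPoincare4.SmoothPoincare4.Theorems.CongruenceShadowsWaldhausenPairsStubVanKampenGluedHandlebodies
import Summits.SmoothPoincare4.SmoothPoincare4.Theorems.CongruenceShadowsWaldhausenPairsStubKernelPairTransport
import Literature.Topology.FourManifolds.FreeFundamentalGroupThreeManifold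
import Literature.Topology.FourManifolds.ThickenedHandlebodyFour
import Literature.Topology.FourManifolds.HeegaardSplittingRealization
import Literature.AlgebraicTopology.FundamentalGroup.VanKampenEpi
import Literature.AlgebraicTopology.FundamentalGroup.CircleAndTorus
import HarnessLib

/-!
# `CongruenceShadows.WaldhausenPairs` from its three named facts (line `jaco-splitting-homomorphism`)

Item stmt-SmoothPoincare4-14592 (crux `WaldhausenPairs` of route `SmoothPoincare4/CongruenceShadows`):
for every balanced `(3+3m, m+1)` group trisection `K` of the trivial group and every `i ≠ j` there
is ONE automorphism `α` of the surface group `S_{3+3m}` with `α(N_i) = K_i` and `α(N_j) = K_j`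
(`N = s4Kernels.stabilizeIter m`, the standard trisection of `S⁴`).

This file proves the crux CONDITIONALLY on exactly the three published 3-dimensional theorems the
route header lists as its fact debt (none of them is in Mathlib; two carry Perelman):

* `Literature.Topology.FourManifolds.exists_heegaardSplitting_realizing_kernels` — Jaco 1969 /
  Hempel, *3-Manifolds*, Lemma 14.5 (kernel form): every ordered pair of genus-`g` handlebody
  kernels of `S_g` (`g ≥ 2`) is the kernel pair of a marked Heegaard splitting of a closed
  orientable 3-manifold;
* `Literature.Topology.FourManifolds.diffeomorph_sumS1S2_of_isFreeOfRank_fundamentalGroup` —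
  Kneser–Stallings + Perelman: a closed orientable 3-manifold with `π₁` free of rank `k` is
  `#ᵏ(S¹ × S²) = ∂(♮ᵏ S¹ × B³)`;
* `Literature.Topology.FourManifolds.waldhausen_heegaardSplitting_sumS1S2_unique` — Waldhausen 1968:
  genus-`g` Heegaard splittings of `#ᵏ(S¹ × S²)` are unique up to diffeomorphism of ordered triples.

Everything else is PROVED: Seifert–van Kampen for the glued handlebodies
(`stub_vanKampenGluedHandlebodies`) with the seam dictionary (`stub_seamDictionary`), transport of
kernel pairs along a diffeomorphism of triples (`stub_kernelPairTransport`) — the three landed stub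
files of the line —, the model `4`-dimensional `1`-handlebody `exists_oneHandlebody_four`, the
composite `heegaardSplittings_diffeomorphic_of_isFreeOfRank`, and the refuter's reduction of the crux
to the ordered Heegaard-pair orbit statement (Disproof §C).  The proof is Hempel's proof of his
Thm. 14.6 transplanted from `S³` to `#ᵏ(S¹ × S²)`:
REALISE both ordered kernel pairs as marked Heegaard splittings (Hempel 14.5), compute `π₁` of the
two glued manifolds by van Kampen (free of rank `k`), RECOGNISE both as `∂(♮ᵏ S¹ × B³)` (KSP) and
COMPARE the splittings there (Waldhausen), TRANSPORT the diffeomorphism of triples to one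
automorphism of `S_g` carrying one kernel pair onto the other.  Intermediate theorem:
`heegaardPairOrbit_of_facts` — ordered Heegaard pairs of type `(g, k)` form ONE `Aut(S_g)`-orbit,
for every `g ≥ 2` and every `k`; the crux is its instance `(g, k) = (3+3m, m+1)`.

Honesty about the trust base: the result is CONDITIONAL (three named-fact hypotheses; the gate
records `conditional-result`); discharging any of them is a literature-prover task of size XL.
By the crux notes (Cruxes/WaldhausenPairs/NOTES.md §1) no proof avoiding a Perelman-bearing fact
exists (WaldhausenPairs + classical 3-manifold topology ⇒ Poincaré-3).
-/

-- the prescribed namespace `Summit.<P>.<Sub>.…` duplicates `SmoothPoincare4` (P = Sub)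
set_option linter.dupNamespace false

noncomputable section

open scoped Manifold ContDiff Topology
open Set Function Subgroup Literature.Topology.FourManifolds
open Summit.SmoothPoincare4.SmoothPoincare4.Theses.CongruenceShadows (WaldhausenPairs)
open Summit.SmoothPoincare4.SmoothPoincare4.Theorems.WaldhausenPairs.Negative
  (stabilizeIter_isGroupTrisection)
open Literature.AlgebraicTopology.FundamentalGroup (fundamentalGroupEquivOfHomeomorph)
open Literature.AlgebraicTopology.FundamentalGroup.VanKampen (inclHomOfSubset)

namespace Summit.SmoothPoincare4.SmoothPoincare4.Theorems

namespace WaldhausenPairs.JacoSplittingHomomorphism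

/-! ## Hempel Lemma 14.4: `π₁` of the glued manifold is the pair quotient -/

/-- **Seifert–van Kampen for a Heegaard splitting, abstract kernel form** (Hempel Lemma 14.4;
Hatcher Thm. 1.20): for a genus-`g` Heegaard splitting `Y = H₁ ∪_f H₂` (pieces `j₁`, `j₂`) and
`x ∈ ∂H₁`, if `π₁(∂H₁, x)/⟪ker π₁(incl₁) ∪ ker π₁(incl₂ ∘ f)⟫` is free of rank `k` then
`π₁(Y, j₁ (incl₁ x))` is free of rank `k`.  Proof: the seam dictionary `θ` (`stub_seamDictionary`)
carries the abstract kernel pair onto the subspace kernel pair of the Heegaard surface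
`Σ = j₁(H₁) ∩ j₂(H₂)`, hence their normal closures; by van Kampen (`stub_vanKampenGluedHandlebodies`)
the latter is the kernel of the surjection `π₁(Σ) ↠ π₁(j₁H₁ ∪ j₂H₂)`; first isomorphism theorem;
`j₁H₁ ∪ j₂H₂ = Y`. [cite: Hempel1976, Lemma 14.4] [cite: HatcherAT2002, Thm. 1.20] -/
theorem isFreeOfRank_fundamentalGroup_of_pairQuotient (g k : ℕ)
    (H₁ : Type) [TopologicalSpace H₁] [ChartedSpace (EuclideanHalfSpace 3) H₁] [IsManifold (𝓡∂ 3) ∞ H₁]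
    (H₂ : Type) [TopologicalSpace H₂] [ChartedSpace (EuclideanHalfSpace 3) H₂] [IsManifold (𝓡∂ 3) ∞ H₂]
    (b₁ : BoundaryData (𝓡∂ 3) H₁ (𝓡 2)) (b₂ : BoundaryData (𝓡∂ 3) H₂ (𝓡 2))
    (f : b₁.carrier ≃ₘ⟮𝓡 2, 𝓡 2⟯ b₂.carrier)
    (Y : Type) [TopologicalSpace Y] [T2Space Y] [SecondCountableTopology Y]
    [ChartedSpace (EuclideanSpace ℝ (Fin 3)) Y] [IsManifold (𝓡 3) ∞ Y]
    (j₁ : H₁ → Y) (j₂ : H₂ → Y) (hH₁ : IsHandlebody g H₁) (hH₂ : IsHandlebody g H₂)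
    (hj : IsBoundaryGluingWith b₁ b₂ f (𝓡 3) j₁ j₂) (x : b₁.carrier)
    (hfree : IsFreeOfRank (FundamentalGroup b₁.carrier x ⧸ normalClosure
      (((FundamentalGroup.map ⟨b₁.incl, b₁.continuous_incl⟩ x).ker : Set (FundamentalGroup b₁.carrier x)) ∪
        (FundamentalGroup.map ⟨b₂.incl ∘ f, b₂.continuous_incl.comp f.continuous⟩ x).ker)) k) :
    IsFreeOfRank (FundamentalGroup Y (j₁ (b₁.incl x))) k := by
  -- the base point lies on the seam `Σ = j₁(H₁) ∩ j₂(H₂)`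
  have hglue : j₁ (b₁.incl x) = j₂ (b₂.incl (f x)) :=
    (hj.apply_eq_apply_iff _ _).2 ⟨x, rfl, rfl⟩
  have hx : j₁ (b₁.incl x) ∈ range j₁ ∩ range j₂ :=
    ⟨mem_range_self _, ⟨b₂.incl (f x), hglue.symm⟩⟩
  obtain ⟨θ, hθ₁, hθ₂⟩ := stub_seamDictionary H₁ H₂ b₁ b₂ f Y j₁ j₂ hj x hx
  obtain ⟨hsurj, hker⟩ :=
    stub_vanKampenGluedHandlebodies g H₁ H₂ b₁ b₂ f Y j₁ j₂ hH₁ hH₂ hj (j₁ (b₁.incl x)) hx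
  -- the normal closure of the abstract kernel pair goes to the kernel of `π₁(Σ) → π₁(j₁H₁ ∪ j₂H₂)`
  have hmap : (normalClosure
      (((FundamentalGroup.map ⟨b₁.incl, b₁.continuous_incl⟩ x).ker :
          Set (FundamentalGroup b₁.carrier x)) ∪
        (FundamentalGroup.map ⟨b₂.incl ∘ f, b₂.continuous_incl.comp f.continuous⟩ x).ker)).map
        θ.toMonoidHom =
      (inclHomOfSubset
          (inter_subset_left.trans subset_union_left : range j₁ ∩ range j₂ ⊆ range j₁ ∪ range j₂)
          (j₁ (b₁.incl x)) hx (Or.inl hx.1)).ker := by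
    rw [hker, map_normalClosure _ _ θ.surjective, image_union, ← coe_map, ← coe_map, hθ₁, hθ₂]
  have hU : IsFreeOfRank
      (FundamentalGroup ↥(range j₁ ∪ range j₂) ⟨j₁ (b₁.incl x), Or.inl hx.1⟩) k :=
    (hfree.of_mulEquiv (QuotientGroup.congr _ _ θ hmap)).of_mulEquiv
      (QuotientGroup.quotientKerEquivOfSurjective _ hsurj)
  -- `j₁(H₁) ∪ j₂(H₂) = Y`
  let η : ↥(range j₁ ∪ range j₂) ≃ₜ Y :=
    (Homeomorph.setCongr hj.range_union_range).trans (Homeomorph.Set.univ Y)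
  exact hU.of_mulEquiv (fundamentalGroupEquivOfHomeomorph η rfl)

/-! ## Plumbing -/

/-- Transport of the pair quotient along a marking: if `A = μ⁻¹K₁`, `B = μ⁻¹K₂` for an isomorphism
`μ : S_g ≅ G` then `S_g/⟪A ∪ B⟫ ≅ G/⟪K₁ ∪ K₂⟫`, so rank-`k` freeness transfers. [folklore] -/
theorem isFreeOfRank_quotient_of_comap {g k : ℕ} {G : Type*} [Group G]
    (μ : SurfaceGroup g ≃* G) (K₁ K₂ : Subgroup G)
    (h : IsFreeOfRank (SurfaceGroup g ⧸ normalClosure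
      (((K₁.comap μ.toMonoidHom : Subgroup (SurfaceGroup g)) : Set (SurfaceGroup g)) ∪
        (K₂.comap μ.toMonoidHom : Subgroup (SurfaceGroup g)))) k) :
    IsFreeOfRank (G ⧸ normalClosure ((K₁ : Set G) ∪ K₂)) k := by
  have hsurj : Function.Surjective μ.toMonoidHom := μ.surjective
  have h1 : (K₁.comap μ.toMonoidHom).map μ.toMonoidHom = K₁ :=
    map_comap_eq_self_of_surjective hsurj _
  have h2 : (K₂.comap μ.toMonoidHom).map μ.toMonoidHom = K₂ :=
    map_comap_eq_self_of_surjective hsurj _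
  have hmap : (normalClosure
      (((K₁.comap μ.toMonoidHom : Subgroup (SurfaceGroup g)) : Set (SurfaceGroup g)) ∪
        (K₂.comap μ.toMonoidHom : Subgroup (SurfaceGroup g)))).map μ.toMonoidHom =
      normalClosure ((K₁ : Set G) ∪ K₂) := by
    rw [map_normalClosure _ _ hsurj, image_union, ← coe_map, ← coe_map, h1, h2]
  exact h.of_mulEquiv (QuotientGroup.congr _ _ μ hmap)

/-! ## Ordered Heegaard pairs form one orbit (Hempel's proof of Thm 14.6 over `#ᵏ S¹ × S²`) -/

/-- **Ordered Heegaard pairs of type `(g, k)` form one `Aut(S_g)`-orbit, for every `g ≥ 2` and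
every `k` — given Hempel 14.5, Kneser–Stallings–Perelman and Waldhausen.**  For normal subgroups
`A, B, A', B'` of `S_g` with all four quotients free of rank `g` and both pair quotients
`S_g/⟪A ∪ B⟫`, `S_g/⟪A' ∪ B'⟫` free of rank `k`, some automorphism of `S_g` carries `A` onto `A'`
AND `B` onto `B'`.  Proof: realise both pairs as marked Heegaard splittings (`hJ`); both glued
manifolds have `π₁` free of rank `k` (`isFreeOfRank_fundamentalGroup_of_pairQuotient`); put them on
the boundary of the tree's `4`-dimensional `1`-handlebody with `k` one-handles
(`exists_oneHandlebody_four`, `nonempty_boundaryData_holds`) and compare the splittings there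
(`heegaardSplittings_diffeomorphic_of_isFreeOfRank hK hW`: a diffeomorphism of TRIPLES); transport
the kernel pairs along it (`stub_kernelPairTransport`).  This is the refuter's `HeegaardPairOrbit g k`
(Cruxes/WaldhausenPairs/Disproof.lean §C), spelled out. [cite: Hempel1976, proof of Thm. 14.6]
[cite: Waldhausen1968] [cite: AbramsGayKirby2018, p. 4] -/
theorem heegaardPairOrbit_of_facts
    (hJ : exists_heegaardSplitting_realizing_kernels.{0})
    (hK : diffeomorph_sumS1S2_of_isFreeOfRank_fundamentalGroup.{0})
    (hW : waldhausen_heegaardSplitting_sumS1S2_unique.{0}) (g k : ℕ) (hg : 2 ≤ g) :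
    ∀ A B A' B' : Subgroup (SurfaceGroup g), A.Normal → B.Normal → A'.Normal → B'.Normal →
      IsFreeOfRank (SurfaceGroup g ⧸ normalClosure (A : Set (SurfaceGroup g))) g →
      IsFreeOfRank (SurfaceGroup g ⧸ normalClosure (B : Set (SurfaceGroup g))) g →
      IsFreeOfRank (SurfaceGroup g ⧸ normalClosure (A' : Set (SurfaceGroup g))) g →
      IsFreeOfRank (SurfaceGroup g ⧸ normalClosure (B' : Set (SurfaceGroup g))) g →
      IsFreeOfRank (SurfaceGroup g ⧸ normalClosure ((A : Set (SurfaceGroup g)) ∪ B)) k →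
      IsFreeOfRank (SurfaceGroup g ⧸ normalClosure ((A' : Set (SurfaceGroup g)) ∪ B')) k →
      ∃ α : SurfaceGroup g ≃* SurfaceGroup g,
        A.map α.toMonoidHom = A' ∧ B.map α.toMonoidHom = B' := by
  intro A B A' B' hA hB hA' hB' hAf hBf hA'f hB'f hAB hA'B'
  -- realise both ordered pairs as marked Heegaard splittings (Hempel 14.5)
  obtain ⟨H₁, _, _, _, H₂, _, _, _, b₁, b₂, f, Y, _, _, _, _, _, _, _, hYo, j₁, j₂, hH₁, hH₂, hj,
    _, x, μ, rfl, rfl⟩ := hJ g hg A B hA hB hAf hBf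
  obtain ⟨H₁', _, _, _, H₂', _, _, _, b₁', b₂', f', Y', _, _, _, _, _, _, _, hYo', j₁', j₂', hH₁', hH₂',
    hj', hconn', x', μ', rfl, rfl⟩ := hJ g hg A' B' hA' hB' hA'f hB'f
  -- both glued manifolds have `π₁` free of rank `k` (Hempel 14.4)
  have hY : IsFreeOfRank (FundamentalGroup Y (j₁ (b₁.incl x))) k :=
    isFreeOfRank_fundamentalGroup_of_pairQuotient g k H₁ H₂ b₁ b₂ f Y j₁ j₂ hH₁ hH₂ hj x
      (isFreeOfRank_quotient_of_comap μ _ _ hAB)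
  have hY' : IsFreeOfRank (FundamentalGroup Y' (j₁' (b₁'.incl x'))) k :=
    isFreeOfRank_fundamentalGroup_of_pairQuotient g k H₁' H₂' b₁' b₂' f' Y' j₁' j₂' hH₁' hH₂' hj' x'
      (isFreeOfRank_quotient_of_comap μ' _ _ hA'B')
  -- the model `V ≅ ♮ᵏ S¹×B³` and its boundary datum (tree, PROVED)
  obtain ⟨V, _, _, _, _, _, _, _, hVo, hV, -⟩ := exists_oneHandlebody_four k
  obtain ⟨bV⟩ := nonempty_boundaryData_holds 3 V
  -- Kneser–Stallings–Perelman + Waldhausen: a diffeomorphism of TRIPLES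
  obtain ⟨Φ, ψ₁, ψ₂, hΦ₁, hΦ₂⟩ := heegaardSplittings_diffeomorphic_of_isFreeOfRank hK hW k V hV hVo bV
    Y hYo (j₁ (b₁.incl x)) hY Y' hYo' (j₁' (b₁'.incl x')) hY' g H₁ H₂ b₁ b₂ f j₁ j₂ hH₁ hH₂ hj
    H₁' H₂' b₁' b₂' f' j₁' j₂' hH₁' hH₂' hj'
  -- transport the kernel pair along it
  exact stub_kernelPairTransport g H₁ H₂ b₁ b₂ f Y j₁ j₂ hj x μ H₁' H₂' b₁' b₂' f' Y' j₁' j₂' hj'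
    hconn' x' μ' Φ ψ₁ ψ₂ hΦ₁ hΦ₂

end WaldhausenPairs.JacoSplittingHomomorphism

open WaldhausenPairs.JacoSplittingHomomorphism

/-- **The crux `CongruenceShadows.WaldhausenPairs`, conditionally on its three named facts**
(Hempel 14.5 `exists_heegaardSplitting_realizing_kernels`, Kneser–Stallings–Perelman
`diffeomorph_sumS1S2_of_isFreeOfRank_fundamentalGroup`, Waldhausen 1968
`waldhausen_heegaardSplitting_sumS1S2_unique`, all at universe `0`): for every balanced
`(3+3m, m+1)` group trisection `K` of the trivial group and every `i ≠ j` ONE automorphism of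
`S_{3+3m}` carries the standard pair `(N_i, N_j)` onto `(K_i, K_j)`.  It is the `(3+3m, m+1)`
instance of `heegaardPairOrbit_of_facts` (the fields `triple` and the third `free_quotient` of
`IsGroupTrisection` are never used; the standard triple is a group trisection of `{1}` at every `m`
by the landed `Negative.stabilizeIter_isGroupTrisection`; `2 ≤ 3 + 3m`).  CONDITIONAL result: the
three hypotheses are exactly the route's registered fact debt for this item.
[cite: Hempel1976, Lemma 14.5 and Thm. 14.6] [cite: Waldhausen1968] [cite: AbramsGayKirby2018, p. 4] -/
theorem waldhausenPairs_of_facts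
    (hJ : exists_heegaardSplitting_realizing_kernels.{0})
    (hK : diffeomorph_sumS1S2_of_isFreeOfRank_fundamentalGroup.{0})
    (hW : waldhausen_heegaardSplitting_sumS1S2_unique.{0}) : WaldhausenPairs := by
  intro m K hK' i j hij
  have hN := stabilizeIter_isGroupTrisection m
  exact heegaardPairOrbit_of_facts hJ hK hW (3 + 3 * m) (m + 1) (by omega)
    (s4Kernels.stabilizeIter m i) (s4Kernels.stabilizeIter m j) (K i) (K j)
    (hN.normal i) (hN.normal j) (hK'.normal i) (hK'.normal j)
    (hN.free_quotient i) (hN.free_quotient j) (hK'.free_quotient i) (hK'.free_quotient j)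
    (hN.free_pairQuotient i j hij) (hK'.free_pairQuotient i j hij)

end Summit.SmoothPoincare4.SmoothPoincare4.Theorems

end
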